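import Literature.NumberTheory.EllipticCurves.Kato2004.ZetaClassOnRankLeOneBranch
import Literature.NumberTheory.EllipticCurves.Kato2004.EllipticUnitKummerCupValues
import Literature.NumberTheory.EllipticCurves.Kato2004.IwasawaCohomologyNumberFieldRestriction
import Literature.NumberTheory.EllipticCurves.Kato2004.IwasawaCohomologyNumberFieldIsogeny
import Literature.NumberTheory.EllipticCurves.ZpExtensionArtinExponent
import HarnessLib

/-!
# Kato 2004 (Astérisque 295) (15.16.1) READ ON THE PINNED CARRIERS, AFTER `⊗ ℚ`: the Λ-adic elliptic-unit class
# `euK 𝔟` (Kummer ∪ `e`, corestricted — (15.6.1)∘(15.12.1)∘15.14) and the Shapiro restriction `res y` of a REALISED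
# value-pinned `(c, d₁, a, A)`-family of `ℚ`-side zeta classes are PROPORTIONAL in `𝐇¹_{K,Γ}(T_pW_K)`, with the explicit
# `𝔟`-dependence `N𝔟·([ε_𝔟] − σ_𝔟)` (Kato's `x_𝔟 = N𝔟 − σ_𝔟` in twisted coordinates), Kato's Λ-adic multiplier `M̃` of
# the family (Lemma 13.10 (1)), and ONE constant `(α₀ + α₁φ)·w ∈ (O_K ⊗ ℤ_p ∖ 0)·Λˣ` up to a power of `p` — `F-P1`

Topic `NumberTheory/EllipticCurves`, sub-directory `Kato2004`, namespace `…Kato2004.CM` (the namespace of `h159′ =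
CM.prop159_kummerCup_expStar_values`).  ONE named fact (`def … : Prop`, D-0014: nothing asserted, no `_holds`; PUBLISHED:
Kato (15.16.1) with (15.6.1)–(15.6.3), (15.12.1), 15.13/15.14, Thm. 12.5 (1), §13.9, Lemma 13.10 (1)); no instance, no
notation, no `sorry`.  Typed by seat `bsd-cm-k-ty1` g34 (literature-prover, cell bsd-cm) on the planner's words D1108 (R5′)
«F-P1 TYPING is a successor task (L; Literature `Kato2004/`, statement over `HasRealisedZetaFamilyBody` data + the Kummer
column; faithful because carriers are pinned up to unique iso and it speaks of CLASSES)» and D1113, in the critic's typing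
(P1) of idea-crit-15 g17 NOTE #14 (W1-c) «address it to the REALISED FAMILIES, which ARE pinned».  Consumer (Summits side,
nothing of it asserted here): crux `EllipticUnitValueSevenOfGZK` = stmt-BirchSwinnertonDyer-19945, stub (S-D)
`stub_katoExpPadicDatumSeven` of `Cruxes/EllipticUnitValueSevenOfGZK/Lines/kato_perrin_riou_zp.lean` v19 — together with
`h159″ = CM.prop159_kummerCup_expStar_values_linear` (the VALUES of `euK 𝔟`) this class identity turns the `ℚ`-side
★-position of `zOne` into the (eZ′) value law of `res zOne` (pen D1108: «kernel = F-P1 typing + the cancellation»).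

## The printed statements (K. Kato, Astérisque 295 (2004); `[p. N]` = printed page = store `paper:doi-10-24033-ast-639` PDF
## page `N − 115`; re-read 2026-08-31: p0139, p0141–p0142, p0146–p0150)

* **§15.6 [p. 254]** "We define an element `z_{p^∞𝔣} ∈ 𝔥¹ ⊗_{ℤ_p[[G_{p^∞𝔣}]]} Q(ℤ_p[[G_{p^∞𝔣}]])` by
  `z_{p^∞𝔣} = (N(𝔞) − (𝔞, K(p^∞𝔣)/K))⁻¹ (_𝔞z_{pⁿ𝔣})_n` where `𝔞` is any ideal of `O_K` which is prime to `6p𝔣` … Then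
  `z_{p^∞𝔣}` is independent of the choice of `𝔞`, for `(N(𝔟) − (𝔟, K(p^∞𝔣)/K))(_𝔞z_{pⁿ𝔣})_n = (N(𝔞) − (𝔞, K(p^∞𝔣)/K))(_𝔟z_{pⁿ𝔣})_n`
  for any ideals `𝔞, 𝔟` of `O_K` which are prime to `6p𝔣` by (15.4.4).  We have: **(15.6.3)**
  `(N(𝔞) − (𝔞, K(p^∞𝔣)/K)) z_{p^∞𝔣} ∈ 𝔥¹` for any ideal `𝔞` of `O_K` which is prime to `6p𝔣`."
* **§15.8 [pp. 256–257]** "the action of `Gal(K^{ab}/K)` on `V_{L_λ}(ψ)` factors through `Gal(K(p^∞𝔣)/K)`, and for an ideal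
  `𝔞` of `O_K` which is prime to `p𝔣`, `(𝔞, K(p^∞𝔣)/K)` acts on `V_{L_λ}(ψ)` as the multiplication by `ψ(𝔞)⁻¹`."
* **§15.12 [p. 263]** "Let `λ` be a finite place of `L`. Then we have a canonical homomorphism of `O_λ[[G_{p^∞𝔣}]]`-modules
  **(15.12.1)** `H¹_{p^∞𝔣} ⊗ T(−1) → 𝐇¹(T~)` since `𝐇¹(V_{L_λ}(f)) = 𝐇¹(V_{L_λ}(ψ)~) = lim←_n H¹(O_K ⊗ ℤ[ζ_{p^n}, 1/p], T) ⊗ ℚ`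
  where `T` is any `Gal(ℚ̄/K)`-stable `O_λ`-lattice of `V_{L_λ}(ψ)`, and since we have a canonical homomorphism
  `H¹_{p^∞𝔣} ⊗ T(−1) → lim←_n H¹(O_{K ⊗ ℚ(ζ_{p^n})}[1/p], T)`" [Kummer class of the unit, cup product with the element of
  `T(−1)`, corestriction].
* **15.14 [p. 264]** "In the case `K ⊂ ℚ(ζ_{p^∞})`, Lemma 15.13 is modified as follows. Let `G′_∞ = Gal(ℚ(ζ_{p^∞})/K) ⊂ G_∞`,
  and let `H^q(T) = lim←_n H^q(ℤ[ζ_{p^n}, 1/p], T)`. Then `𝐇^q(T~) = H^q(T) ⊗_{O_λ[[G′_∞]]} O_λ[[G_∞]]`."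
* **§15.16 [p. 265]** "We prove Thm. 12.5 and Thm. 12.6 for `f` in the case `K` is not contained in `ℚ(ζ_{p^∞})`. Since we
  have already proved Thm. 12.4 for `f`, Thm. 12.5 (1) (2) and Thm. 12.6 are proved by the same arguments in 13.9–13.13. …
  By (15.12.2) and Thm. 12.4 (2), we have: **(15.16.1)** Let `γ ∈ V_L(ψ)` and let `γ′` be the image of `γ` in `V_L(f)` under
  (15.11.3). Then the homomorphism (15.12.1) sends `z_{p^∞𝔣} ⊗ γ ⊗ (ζ_{p^n})_n^{⊗(−1)}` to `z^{(p)}_{γ′}`."  **Prop. 15.17,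
  proof, last line [p. 265]** "The proof for the case `K ⊂ ℚ(ζ_{p^∞})` goes similarly by using 15.14 instead of 15.13."
* **Thm. 12.5 (1) [p. 221]** (the UNIQUE `F_λ`-linear `γ ↦ z_γ^{(p)}` with the `exp*`-values); **§13.9 [p. 230 l. 8–9]** "Since
  `𝐇¹(V_{F_λ}(f))` is a free `Λ[1/p]`-module of rank 1 (Thm. 12.4 (2)), this shows that `z_γ^{(p)}` is independent of the
  choices"; **Lemma 13.10 (1) [p. 230]** (the integral `(c, d)`-class `= μ(c, d, j)·∏_{ℓ∣A}(Euler factors)·z^{(p)}_{δ(f,j,a(A))}`).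

SCOPE (honest): (15.16.1) is PRINTED for `K ⊄ ℚ(ζ_{p^∞})` and ASSERTED «similarly by using 15.14» for `K ⊂ ℚ(ζ_{p^∞})`
(the consumer's case `K = ℚ(√−7)`, `p = 7`); what is transcribed below is its reading AFTER `⊗ ℚ` (a power `p^t` is
allowed) — i.e. exactly «(15.12.2) and Thm. 12.4 (2)» (values + rank one), both printed for every CM newform and every
`p` (§15.15 covers the two cases of Thm. 12.4).  The INTEGRALITY of the comparison constant at `π ∣ p` (the constant is a
unit of `Λ_O` at `π`) is NOT asserted: it is the research kernel of crux K2ᶜ (`ComparisonDivisibilityShape`, Summits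
side), not a statement of the book.

## The tree-currency reading (frozen memo `MEMO-bsd-cm-genus` v1 §3 (F1)–(F3), §4 (L4), §9; typing map
## `GenusTypingMap-g57.md` REV 1.1 rows C2/C5/C6; `Kato2004/CMTwistedIwasawaModules.lean` module docstring; NOTE #12/#14)

* **Carriers.**  `I : IwasawaH1Data W p κ γ` is the `Δ`-trivial branch of Kato's `𝐇¹` of `T_pW` along the cyclotomic
  `ℤ_p`-extension `κ` of `ℚ` (`𝐇¹_Γ(T_pW)`); `IK : IwasawaH1DataOver (W.baseChange K) p (κ.restrict K h) γK` is the `K`-side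
  `𝐇¹_{K,Γ}(T_pW_K) = lim← H¹(O_{Kℚ_n}[1/p], T_pW)` (= `𝐇′(S′_W)` by 15.14/Shapiro); `I.resOver IK hγ hγK` is the Shapiro
  restriction (the coefficient extension `x ⊗ a ↦ a·res x` of `𝐇¹(V(f)) ⊗ K_𝔭 → 𝐇¹_{K,Γ} ⊗ ℚ`); the `O_K`-action on the
  coefficients (Kato's `O_λ`-module structure, 15.14) is `IK.isogenyMap φ IK hγK` for the CM endomorphism `φ` (`φ ∘ φ = [m]`,
  `m < 0`, so `ℚ(φ) = K`).  Kato's lattice is cohomological (`det = κ_cyc⁻¹`), the tree's is `T_pW = H¹_ét(W̄, ℤ_p)(1)`: the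
  Tate twist `x ↦ x ∪ (ζ_{p^n})_n` is applied on BOTH sides (memo (F1)), so the `(ζ_{p^n})^{⊗(−1)}` of (15.16.1) cancels: the
  tree's Kummer column twists by `e = (e_k)_k ∈ T_p(W_K)` itself (`KummerFrame.e`; memo (F3)).
* **The column.**  `euK 𝔟 := F.iwasawaClass u (κ.restrict K h) hV IK` (`Kato2004/EllipticUnitKummerCupClass.lean`) for a
  Kummer frame `F` ON THE RAY-CLASS TOWER (`F.V s = Gal(K̄/K(W_K[p^s f]))`, `e ≠ 0`) and a unit tower `u` PINNED to Kato's
  elliptic units `_𝔟z_{p^s𝔣}` at the levels `s ≥ 1` (`IsKatoUnitRepAt`, as in `h159′`): the image of `(_𝔟z_{p^s𝔣})_s ⊗ e`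
  under (15.6.1)∘(15.12.1), corestricted to the layers `Kℚ_n` (`hV : Kℚ_n ⊆ K(W_K[p^{n+1}f])`).
* **The identity, derived from the print by the DIAGONAL action (proof of Lemma 15.13, p. 264: "`σ` acts … by the
  multiplication by the image of `σ⁻¹`").**  Write `Φ(z ⊗ e) ∈ 𝐇¹_{K,Γ}` for the class of a unit family `z` twisted by `e`; the
  action of `g ∈ Γ_K` on the explicit cocycle `x ↦ a_x(z)·e_k` (`x(z^{1/p^k}) = ζ_k^{a_x(z)} z^{1/p^k}`) is
  `(g·c)(x) = g·c(g⁻¹xg)` (the tree's `conjMap`, `ContinuousCorestriction.lean`), whence `Φ(gz ⊗ e) = χ_cyc(g)·[ε(g)]⁻¹·g·Φ(z ⊗ e)`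
  where `g·e_k = [ε(g)] e_k`.  With Kato's `(_𝔟z) = (N𝔟 − σ_𝔟)·z_{p^∞𝔣}` (§15.6) and `z′ := Φ(z_{p^∞𝔣} ⊗ e)` (a class of
  `𝐇¹_{K,Γ} ⊗ ℚ`): `[ε_𝔟]·euK 𝔟 = N𝔟·([ε_𝔟] − σ_𝔟)·z′`, `σ_𝔟 = (1 + X)^{κ(𝔟)}` the image of the Artin symbol in `Λ`
  (`ZpExtension.artinExponent`), `[ε_𝔟] ∈ O_K = End_K(W_K)` the endomorphism by which the Artin symbol of `𝔟` acts on the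
  torsion points `e_k` (carried as a HYPOTHESIS on the frame's own `e_k`, through `layerArtin` — §15.8's «`ψ(𝔞)⁻¹`» is NOT
  transcribed: no Grössencharacter value, no orientation convention enters the identity).  By (15.16.1) and Thm. 12.5 (1)
  (uniqueness on the rank-one branch, §13.9), `z′ = c · res 𝐳_{γ_W}` with `c ∈ (K ⊗ ℚ_p)^×` (`γ′` has `γ′⁺ ≠ 0`; `e` is an
  arbitrary non-zero element of `T_p(W_K)`, so `c` is `p`-ADIC — pen D1085 (ρ1)); by Lemma 13.10 (1)/§13.9 the realised
  family's lift has `M̃ · 𝐳_{γ_W} = u·p^e·y` (`M̃ = katoMultiplier …`, `u ∈ Λˣ`; module docstring of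
  `Kato2004/AdmissibleZetaClass.lean`, «WHY THIS IS KATO'S ELEMENT»).  Eliminating `z′` and `𝐳_{γ_W}`:
  **`[ε_𝔟] · (p^t M̃) · euK 𝔟 = N𝔟 · ([ε_𝔟] − σ_𝔟) · (α₀ + α₁φ) · w · res y`** in `IK.H`, for some `t ∈ ℕ`, `(α₀, α₁) ∈ ℤ_p² ∖ 0`,
  `w ∈ Λˣ` INDEPENDENT of `𝔟` and of the unit tower — the CONCLUSION below, with `[ε_𝔟] = (b₀ + b₁φ)/N_b` cleared of its
  denominator `N_b`.
* **The support of `f`.**  Prop. 15.9 gives the values of the elliptic-unit classes as the `p𝔣`-DEPLETED values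
  `L_{p𝔣}(ψ̄, χ, 1)` («`𝔞` ranges over all ideals of `O_K` which are prime to `p𝔣`», p. 258), Thm. 12.5 (1) those of `z_γ` as
  `L_{(p)}(f, χ, 1) = L_{(p)}(ψ·(χ ∘ N), 1)`; the two agree at every character of `p`-power conductor iff `ψ` vanishes at every
  prime of `𝔣` prime to `p`, i.e. iff every prime factor `ℓ ≠ p` of `f` is a prime of BAD reduction of `W` (for a CM curve over
  `ℚ`, `N_W = |d_K|·N(cond ψ)` and `cond ψ` is stable under complex conjugation).  This is carried as the HYPOTHESIS
  `ℓ ∣ f → ℓ ≠ p → ¬ W.HasGoodReductionAtPrime ℓ` (the consumer's `f = 7·|D|`, all of whose primes are bad for the twist);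
  for a general `f` with `cond ψ ∣ (f)` the identity holds only after multiplying the `ℚ`-side by the Euler factors
  `∏_{𝔩 ∣ f, 𝔩 ∤ p·cond ψ} (1 − [ψ̄(𝔩)]·N𝔩⁻¹·σ_𝔩) ∈ Λ_O` — NOT transcribed.
  -- TODO(general form): general `f ⊆ cond ψ` with the depletion factor at the primes of `f` outside `p·cond ψ`.
* **What is a hypothesis, what is the conclusion.**  Hypotheses: the admissible `(W, K, ψ, ι, f)` VERBATIM as in `h159′`
  (`ψ` only pins `f`: `cond ψ ∣ (f)`; no value of `ψ` is used) plus the support condition on `f`, any odd `p` (the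
  realisation data force `p ≠ 2`), the two
  pins `I`, `IK` with topological generators, the Kummer frame on the ray-class tower with `e ≠ 0` and `hV`, the CM endomorphism
  `φ`, ONE realised family ((A0)–(A4), (A5′), (A6′-scalars) of `HasRealisedZetaFamilyBody`, same binders, universally
  quantified — at the consumer supplied by `hR : ∃ z₀, IsAdmissibleZetaClass …`, D1111 (x1)); then, after the constant is
  chosen: every `𝔟` prime to `6pf`, every pinned unit tower, and the integer coordinates `(b₀, b₁, N_b)` of `[ε_𝔟]` in the
  basis `(1, φ)` read on the torsion points `e_k`.  Conclusion: the displayed identity.  Vacuous if no family is realised in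
  `I.H` or if no `𝔟`/tower/coordinates satisfy the hypotheses (nothing is then claimed).

WHAT THIS IS NOT: not the integral comparison (K2ᶜ); not a value statement ((15.12.2)/(15.9.1) are `h159′`/`h159″`);
not Thm. 12.5 (2) (non-vanishing — carried by `ZetaClassPosition`); no identification of `[ε_𝔟]` with `ψ(𝔟)` (§15.8; the
consumer's (e2)/(Z3c) orientation); no construction of (15.12.1) as a map on `H¹_{p^∞𝔣} ⊗ T(−1)` (only its values on the
pinned towers, which is what `KummerFrame.iwasawaClass` is); nothing about Conj. 12.10 or BSD; no summit statement touched.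
-- TODO(general form): (15.16.1) INTEGRALLY in `𝐇¹(T~)_𝔮` (Lemma 15.13 / 15.14 book-keeping) once (15.12.1) is a typed map
-- of `O_λ[[G_{p^∞𝔣}]]`-modules; weight `k ≥ 3` (`ψ` of type `(−r, 0)`); the constant `c` named through (15.11.3) and `per_f`.

## References

* [Kato2004Asterisque] K. Kato, *p-adic Hodge theory and values of zeta functions of modular forms*, Astérisque 295 (2004):
  §15.5–15.6 (15.6.1)–(15.6.3) (pp. 253–254), §15.8 (pp. 256–257), Lemma 15.11 (15.11.2)–(15.11.3) (pp. 260–263), §15.12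
  (15.12.1)–(15.12.2) (p. 263), Lemma 15.13 and 15.14 (p. 264), §15.15–15.16 (15.16.1), Prop. 15.17 (p. 265); Thm. 12.4 (2),
  Thm. 12.5 (1) (p. 221), §13.9 (p. 230), Lemma 13.10 (1) (p. 230).
* [Rubin2000] K. Rubin, *Euler Systems* (2000), App. B §2–§3 (classes in inverse limits); III §3.3–3.4.
* [NeukirchSchmidtWingberg2008] J. Neukirch, A. Schmidt, K. Wingberg (2008), I §5 (conjugation action, `cor`, `res`), XI §2.
* [Washington1997] L. Washington, *Introduction to Cyclotomic Fields*, §13.1–13.2 (the Artin symbol of a `ℤ_p`-extension).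
* Tree: `Kato2004/ZetaClassOnRankLeOneBranch.lean` ((A0)–(A6′) binders, `katoMultiplier`), `Kato2004/EllipticUnitKummerCup{Map,Class,Values}.lean`
  (`KummerFrame`, `UnitTower`, `iwasawaClass`, `IsKatoUnitRepAt`, `h159′`), `Kato2004/IwasawaCohomologyNumberField{,Restriction,Isogeny}.lean`
  (`IwasawaH1DataOver`, `resOver`, `isogenyMap`), `ZpExtensionArtinExponent.lean` (`artinExponent`),
  `ComplexMultiplication/EllipticUnits/KatoEllipticZetaElement.lean` (`katoLayer`, `layerArtin`),
  `Kato2004/CMTwistedIwasawaModules.lean` (the abstract SHAPE `Kato15161StrongShape` this fact instantiates after `⊗ ℚ`).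
  Cell records: STATUS D1085 (ρ1), D1106–D1108, D1111, D1113; critic NOTEs #12–#15; `Cruxes/EllipticUnitValueSevenOfGZK/PRINTFACTS-v19.md`.
-/

noncomputable section

open scoped BigOperators NumberField TensorProduct Classical
open Field IsDedekindDomain NumberField CongruenceSubgroup ValuativeRel
open Literature.NumberTheory.GaloisRepresentations
open Literature.NumberTheory.GaloisRepresentations.PeriodRingData
open Literature.NumberTheory.GaloisRepresentations.IsNonarchimedeanLocalField
open Literature.NumberTheory.PAdicHodge
open Literature.NumberTheory.EllipticCurves Literature.NumberTheory.EllipticCurves.ModularForms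
open Literature.NumberTheory.AdelicBaseChange Literature.NumberTheory.Automorphic
open Literature.NumberTheory.ComplexMultiplication.EllipticUnits
open WeierstrassCurve (geomPoints geomTorsion)

namespace Literature.NumberTheory.EllipticCurves.Kato2004

open EulerSystemValues Rat.HeightOneSpectrum

namespace CM

set_option backward.isDefEq.respectTransparency false in
/-- **Kato 2004, (15.16.1) read on the pinned carriers after `⊗ ℚ` — `F-P1`: the Λ-adic elliptic-unit class `euK 𝔟` and the
Shapiro restriction of a realised `ℚ`-side zeta family are proportional in `𝐇¹_{K,Γ}(T_pW_K)`, with Kato's explicit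
`𝔟`-dependence and multiplier.**  For `W/ℚ` globally minimal with CM by the maximal order of `K` and `(ψ, ι, f)` admissible
EXACTLY as in `prop159_kummerCup_expStar_values` (`h159′`); for a prime `p` such that every prime factor `ℓ ≠ p` of `f` is a
prime of bad reduction of `W` (so that Prop. 15.9's `L_{p𝔣}` and Thm. 12.5 (1)'s `L_{(p)}` deplete the same Euler factors);
for a cyclotomic `ℤ_p`-extension `κ` of `ℚ` with
topological generator `γ` and a pin `I : IwasawaH1Data W p κ γ`; for the restricted tower `κ.restrict K h` with topological
generator `γK` and a pin `IK : IwasawaH1DataOver (W.baseChange K) p (κ.restrict K h) γK`; for a Kummer frame `F` of `W_K` at `p`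
on the ray-class tower (`F.V s = Gal(K̄/K(W_K[p^s f]))`) with `e = (e_k)_k ≠ 0` and the cyclotomic layers inside the Kummer
levels (`hV`); for a `K`-endomorphism `φ` of `W_K` with `φ ∘ φ = [m]`, `m < 0`; and for EVERY value-pinned `(c, d₁, a, A)`-family
REALISED in `I.H` with lift `y` (the binders (A0)–(A4), (A5′), (A6′-scalars) of `HasRealisedZetaFamilyBody`, universally
quantified, multiplier `M̃ = katoMultiplier …`): THERE ARE `t ∈ ℕ`, a `p`-adic pair `(α₀, α₁) ∈ ℤ_p² ∖ {0}` and a unit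
`w ∈ Λˣ` such that for EVERY ideal `𝔟` prime to `6pf`, EVERY unit tower `u` on `F` pinned to Kato's `_𝔟z_{p^s𝔣}` at the levels
`s ≥ 1`, and ALL integers `(b₀, b₁, N_b)`, `N_b ≠ 0`, such that the Artin symbols of `𝔟` on the layers `K(p^s𝔣)` act on the
torsion points by `N_b·(σ_𝔟 · e_k) = b₀·e_k + b₁·φ(e_k)` (`k ≤ s`, `1 ≤ s`):
`(b₀ + b₁φ_*)·(p^t M̃)·euK 𝔟 = N𝔟 · ((b₀ + b₁φ_*) − N_b σ_𝔟) · (C α₀ + C α₁ φ_*) · (w · res y)` in `IK.H`,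
where `euK 𝔟 = F.iwasawaClass u (κ.restrict K h) hV IK`, `res = I.resOver IK hγ hγK`, `φ_* = IK.isogenyMap φ IK hγK`,
`σ_𝔟 = (1 + X)^{artinExponent (κ.restrict K h) 𝔟} ∈ Λ`, `C = PowerSeries.C`.  CONTENT: (15.16.1) («(15.12.1) sends
`z_{p^∞𝔣} ⊗ γ ⊗ ζ^{⊗(−1)}` to `z_{γ′}`») with `(_𝔟z) = (N𝔟 − σ_𝔟) z_{p^∞𝔣}` (§15.6), the diagonal action of (15.12.1)/15.13–15.14
(`x_𝔟 = N𝔟 − [ε_𝔟]⁻¹N𝔟·σ_𝔟` in twisted coordinates), Thm. 12.5 (1)/§13.9 (`z_{γ′} = c · res 𝐳_{γ_W}` on the rank-one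
branch, `c ∈ (K ⊗ ℚ_p)^×`) and Lemma 13.10 (1) (`M̃ 𝐳_{γ_W} = u p^e y`), read AFTER `⊗ ℚ` (the power `p^t`); the integrality
of the constant at `π` is NOT asserted (crux K2ᶜ); no value of `ψ` and no orientation convention enters.  Printed for
`K ⊄ ℚ(ζ_{p^∞})`, asserted «similarly by 15.14» for `K ⊂ ℚ(ζ_{p^∞})`.  Named fact; nothing asserted; no `_holds` expected
(size XL). [cite: Kato2004Asterisque, §15.16 (15.16.1) (p. 265), with §15.6 (15.6.1)–(15.6.3) (p. 254), §15.12 (15.12.1) (p. 263), Lemma 15.13 and 15.14 (p. 264), Prop. 15.17 proof, last line (p. 265), Thm. 12.5 (1) (p. 221), §13.9 (p. 230 l. 8–9), Lemma 13.10 (1) (p. 230)]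
[cite: Rubin2000, App. B §2–§3] [cite: NeukirchSchmidtWingberg2008, I §5 (1.5.6)–(1.5.7)] [cite: Washington1997, §13.1–13.2] -/
def kato15161_ellipticUnitClass_res_zetaFamily : Prop :=
  ∀ (W : WeierstrassCurve ℚ) [W.IsElliptic] [W.IsGloballyMinimal], W.j ∈ maximalCMJInvariants →
  ∀ (K : Type) [Field K] [NumberField K], IsCMFieldOfJ K W.j →
  ∀ (ψ : HeckeCharacter K), ψ.HasInfinityType (fun _ ↦ 1) (fun _ ↦ 0) →
    (∀ s : ℂ, 3 / 2 < s.re → heckeLFunction ψ s = W.LSeries s) →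
  ∀ (ι : AlgebraicClosure K →+* ℂ),
    (∀ (w : InfinitePlace K) (x : K), ι (algebraMap K (AlgebraicClosure K) x) = w.embedding x) →
  ∀ (f : ℕ), 3 ≤ f →
    (∀ α : 𝓞 K, α ≠ 0 → ((f : ℕ) : 𝓞 K) ∣ α - 1 →
      heckeCharIdealValue ψ (Ideal.span {α}) = ι (algebraMap K (AlgebraicClosure K) (α : K))) →
  ∀ (p : ℕ) [Fact p.Prime] [ContinuousSMul ℤ_[p] (W.tateModule p)]
    [ContinuousSMul ℤ_[p] ((W.baseChange K).tateModule p)],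
  -- SUPPORT OF `f`: every prime factor of `f` other than `p` is a prime of BAD reduction of `W` (then `ψ` vanishes at every
  -- prime of `K` dividing `f` and prime to `p`, so Prop. 15.9's `L_{p𝔣}` and Thm. 12.5 (1)'s `L_{(p)}` deplete the same
  -- Euler factors; for a general `f` with `cond ψ ∣ (f)` the two sides below differ by `∏_{𝔩∣f, 𝔩∤p·cond ψ}(1 − ψ̄(𝔩)N𝔩⁻¹σ_𝔩)`)
  (∀ (ℓ : ℕ) [Fact ℓ.Prime], ℓ ∣ f → ℓ ≠ p → ¬ W.HasGoodReductionAtPrime ℓ) →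
  -- the `ℚ`-side pin: a cyclotomic `ℤ_p`-extension of `ℚ`, a topological generator, the Δ-trivial Iwasawa cohomology
  ∀ (κ : ZpExtension ℚ p) (hκ : κ.IsCyclotomic) (γ : absoluteGaloisGroup ℚ) (hγ : κ.IsTopGenerator γ)
    (I : IwasawaH1Data W p κ γ),
  -- the `K`-side pin: the restricted tower `Kℚ_∞/K`, a topological generator, the `K`-side Iwasawa cohomology (15.14)
  ∀ (h : Function.Surjective (κ.toContinuousMonoidHom.comp (absGaloisRestrict ℚ K))) (γK : absoluteGaloisGroup K)
    (hγK : (κ.restrict K h).IsTopGenerator γK) (IK : IwasawaH1DataOver (W.baseChange K) p (κ.restrict K h) γK),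
  -- the Kummer frame on the ray-class tower (as in `h159′`), `e ≠ 0`, and the cyclotomic layers inside the Kummer levels
  ∀ (F : KummerFrame (W.baseChange K) p),
    (∀ s : ℕ, F.V s = torsionLayer (W.baseChange K) (p ^ s * f)) → (∃ k : ℕ, F.e k ≠ 0) →
  ∀ (hV : ∀ n : ℕ, F.V (n + 1) ≤ (κ.restrict K h).layerSubgroup n),
  -- the complex multiplication: a `K`-endomorphism `φ` with `φ ∘ φ = [m]`, `m < 0` (so `ℚ(φ) = K` inside `End ⊗ ℚ`)
  ∀ (φ : WeierstrassCurve.Isogeny (W.baseChange K) (W.baseChange K)) (m : ℤ), m < 0 →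
    (∀ P : geomPoints (W.baseChange K), φ (φ P) = m • P) →
  -- ONE REALISED value-pinned family: VERBATIM the binders (A0)–(A4), (A5′), (A6′-scalars) of `HasRealisedZetaFamilyBody`
  -- (CLOSED form: the `ℤ_p`-structure facts of `T_pW` supplied by the tree theorems, as in `ZetaClassPosition`)
  letI : Module.Free ℤ_[p] (W.tateModule p) := W.module_free_tateModule_holds p
  letI : Module.Finite ℤ_[p] (W.tateModule p) := W.module_finite_tateModule_holds p
  letI ρT := restrictedTateRep W (NumberField.Place.Completion (Sum.inr ((Rat.HeightOneSpectrum.primesEquiv (R := 𝓞 ℚ)).symm ⟨p, Fact.out⟩) : NumberField.Place ℚ)) p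
  letI : ValuativeRel (NumberField.Place.Completion (Sum.inr ((Rat.HeightOneSpectrum.primesEquiv (R := 𝓞 ℚ)).symm ⟨p, Fact.out⟩) : NumberField.Place ℚ)) :=
    inferInstanceAs (ValuativeRel (((Rat.HeightOneSpectrum.primesEquiv (R := 𝓞 ℚ)).symm ⟨p, Fact.out⟩).adicCompletion ℚ))
  letI : TopologicalSpace (NumberField.Place.Completion (Sum.inr ((Rat.HeightOneSpectrum.primesEquiv (R := 𝓞 ℚ)).symm ⟨p, Fact.out⟩) : NumberField.Place ℚ)) :=
    inferInstanceAs (TopologicalSpace (((Rat.HeightOneSpectrum.primesEquiv (R := 𝓞 ℚ)).symm ⟨p, Fact.out⟩).adicCompletion ℚ))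
  haveI : IsNonarchimedeanLocalField (NumberField.Place.Completion (Sum.inr ((Rat.HeightOneSpectrum.primesEquiv (R := 𝓞 ℚ)).symm ⟨p, Fact.out⟩) : NumberField.Place ℚ)) :=
    inferInstanceAs (IsNonarchimedeanLocalField (((Rat.HeightOneSpectrum.primesEquiv (R := 𝓞 ℚ)).symm ⟨p, Fact.out⟩).adicCompletion ℚ))
  haveI : CharZero (NumberField.Place.Completion (Sum.inr ((Rat.HeightOneSpectrum.primesEquiv (R := 𝓞 ℚ)).symm ⟨p, Fact.out⟩) : NumberField.Place ℚ)) := LocalField.charZero_adicCompletion ((Rat.HeightOneSpectrum.primesEquiv (R := 𝓞 ℚ)).symm ⟨p, Fact.out⟩)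
  letI : Algebra ℚ_[p] (NumberField.Place.Completion (Sum.inr ((Rat.HeightOneSpectrum.primesEquiv (R := 𝓞 ℚ)).symm ⟨p, Fact.out⟩) : NumberField.Place ℚ)) :=
    LocalField.adicCompletionPadicAlgebra ((Rat.HeightOneSpectrum.primesEquiv (R := 𝓞 ℚ)).symm ⟨p, Fact.out⟩) p ((natCast_mem_asIdeal_iff_eq_primesEquiv_symm _ (Fact.out : p.Prime)).mpr rfl)
  haveI : Fact (¬ IsUnit ((p : ℕ) : integerC (NumberField.Place.Completion (Sum.inr ((Rat.HeightOneSpectrum.primesEquiv (R := 𝓞 ℚ)).symm ⟨p, Fact.out⟩) : NumberField.Place ℚ)))) :=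
    ⟨not_isUnit_natCast_integerC (show valuation (NumberField.Place.Completion (Sum.inr ((Rat.HeightOneSpectrum.primesEquiv (R := 𝓞 ℚ)).symm ⟨p, Fact.out⟩) : NumberField.Place ℚ)) ((p : ℕ) : (NumberField.Place.Completion (Sum.inr ((Rat.HeightOneSpectrum.primesEquiv (R := 𝓞 ℚ)).symm ⟨p, Fact.out⟩) : NumberField.Place ℚ))) < 1 from LocalField.valuation_adicCompletion_natCast_lt_one ((Rat.HeightOneSpectrum.primesEquiv (R := 𝓞 ℚ)).symm ⟨p, Fact.out⟩) p ((natCast_mem_asIdeal_iff_eq_primesEquiv_symm _ (Fact.out : p.Prime)).mpr rfl))⟩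
  haveI := isAdicComplete_integerC_natCast (show valuation (NumberField.Place.Completion (Sum.inr ((Rat.HeightOneSpectrum.primesEquiv (R := 𝓞 ℚ)).symm ⟨p, Fact.out⟩) : NumberField.Place ℚ)) ((p : ℕ) : (NumberField.Place.Completion (Sum.inr ((Rat.HeightOneSpectrum.primesEquiv (R := 𝓞 ℚ)).symm ⟨p, Fact.out⟩) : NumberField.Place ℚ))) < 1 from LocalField.valuation_adicCompletion_natCast_lt_one ((Rat.HeightOneSpectrum.primesEquiv (R := 𝓞 ℚ)).symm ⟨p, Fact.out⟩) p ((natCast_mem_asIdeal_iff_eq_primesEquiv_symm _ (Fact.out : p.Prime)).mpr rfl))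
  -- the tree's `ℚ`-algebra structure on `ℚ_v` (the one W2's restricted representations are built on) is pinned
  -- as the most recent local instance, so that it — and not `DivisionRing.toRatAlgebra` — is synthesized below
  letI : Algebra ℚ (NumberField.Place.Completion (Sum.inr ((Rat.HeightOneSpectrum.primesEquiv (R := 𝓞 ℚ)).symm ⟨p, Fact.out⟩) : NumberField.Place ℚ)) := NumberField.Place.instAlgebraCompletion (Sum.inr ((Rat.HeightOneSpectrum.primesEquiv (R := 𝓞 ℚ)).symm ⟨p, Fact.out⟩) : NumberField.Place ℚ)
  ∀ (hp : p ≠ 2) (N : ℕ) (_ : NeZero N) (nf : CuspForm (Gamma0 N) 2) (_ : IsNewformOf W nf)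
    (ιcyc : (n : ℕ) → (CyclotomicField n ℚ →+* ℂ)) (q : ℚ)
    (Λv : ∀ (k : ℕ) (r : Finset (HeightOneSpectrum (𝓞 ℚ))),
      H1 (tateRep W p) (cycSubgroup p k r) →ₗ[ℤ_[p]] ℚ_[p] ⊗[ℚ] CyclotomicField (cycLevel p k r) ℚ),
    -- (A0)
    q ≠ 0 →
    -- (A1) ∧ (A2)
    (∃ d, DefinedExpStarBody W p nf d ιcyc ((q : ℚ) : ℝ) Λv ∧
      ∀ a : (NumberField.Place.Completion (Sum.inr ((Rat.HeightOneSpectrum.primesEquiv (R := 𝓞 ℚ)).symm ⟨p, Fact.out⟩) : NumberField.Place ℚ)),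
        (∃ η : contOneCocycles ρT.toTopRep, expStarCoord W (show valuation (NumberField.Place.Completion (Sum.inr ((Rat.HeightOneSpectrum.primesEquiv (R := 𝓞 ℚ)).symm ⟨p, Fact.out⟩) : NumberField.Place ℚ)) ((p : ℕ) : (NumberField.Place.Completion (Sum.inr ((Rat.HeightOneSpectrum.primesEquiv (R := 𝓞 ℚ)).symm ⟨p, Fact.out⟩) : NumberField.Place ℚ))) < 1 from LocalField.valuation_adicCompletion_natCast_lt_one ((Rat.HeightOneSpectrum.primesEquiv (R := 𝓞 ℚ)).symm ⟨p, Fact.out⟩) p ((natCast_mem_asIdeal_iff_eq_primesEquiv_symm _ (Fact.out : p.Prime)).mpr rfl)) d η = a) ↔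
          ∀ Q : (W.baseChange ℚ_[p]).toAffine.Point,
            ‖(Padic.adicCompletionEquiv (𝓞 ℚ) ⟨p, Fact.out⟩).symm
                (show ((Rat.HeightOneSpectrum.primesEquiv (R := 𝓞 ℚ)).symm ⟨p, Fact.out⟩).adicCompletion ℚ from a) * padicLogLocal W p Q‖ ≤ 1) →
    -- (A3)
    ∀ (c d₁ a : ℤ) (A : ℕ) (d' : ℤ),
      0 < A → Int.gcd c (6 * p * A) = 1 → Int.gcd d₁ (6 * p * N) = 1 → (d₁ : ℤ) * d' ≡ 1 [ZMOD (A : ℤ)] →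
      ratCuspFactor nf true c d₁ a A d' ≠ 0 →
    ∀ (z : ∀ (k : ℕ) (r : (cyclotomicLevelsRat p (badPlaces c d₁ A N)).Ideals),
        H1 (tateRep W p) ((cyclotomicLevelsRat p (badPlaces c d₁ A N)).level k r.1))
      (x : ∀ (k : ℕ) (r : (cyclotomicLevelsRat p (badPlaces c d₁ A N)).Ideals),
        CyclotomicField (cycLevel p k r.1) ℚ),
      ZetaBody W p nf ιcyc ((q : ℚ) : ℝ) Λv c d₁ a A z x →
    -- (A4) the realisation datum: the Λ-adic lift `y ∈ I.H`
    ∀ (y : I.H),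
      (∀ n : ℕ, I.proj n y =
        levelToLayer W p hκ hp (badPlaces c d₁ A N) n
          (z (n + 1) (cyclotomicLevelsRat p (badPlaces c d₁ A N)).idealOne)) →
    -- (A5′) ∧ (A6′-scalars)
    ∀ (qm perRatio : ℚ) (e : ℤ) (n₁ n₂ n₃ n₄ : ℤ) (σc σd : absoluteGaloisGroup ℚ)
      (σℓ : ℕ → absoluteGaloisGroup ℚ),
      0 < qm → AddSubgroup.closure (Set.range (ratMinusSymbol nf)) = AddSubgroup.zmultiples qm →
      ratMinusSymbol nf ((a : ℚ) / A) = n₁ * qm → ratMinusSymbol nf ((a * c : ℚ) / A) = n₂ * qm →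
      ratMinusSymbol nf ((a * d' : ℚ) / A) = n₃ * qm → ratMinusSymbol nf ((a * c * d' : ℚ) / A) = n₄ * qm →
      ((GaloisRep.cyclotomicCharacter ℚ p σc : ℤ_[p]ˣ) : ℤ_[p]) = c →
      ((GaloisRep.cyclotomicCharacter ℚ p σd : ℤ_[p]ˣ) : ℤ_[p]) = d₁ →
      (∀ ℓ ∈ A.primeFactors.erase p, ((GaloisRep.cyclotomicCharacter ℚ p (σℓ ℓ) : ℤ_[p]ˣ) : ℤ_[p]) = ℓ) →
      perRatio ≠ 0 → plusPeriod nf = ((perRatio : ℚ) : ℝ) * W.realPeriodRat →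
      padicValRat p (perRatio / (q * qm)) = e →
    -- CONCLUSION: ONE constant `p^{-t}·(α₀ + α₁φ)·w` for the frame, the endomorphism and the family …
    ∃ (t : ℕ) (α₀ α₁ : ℤ_[p]) (_ : α₀ ≠ 0 ∨ α₁ ≠ 0) (w : (IwasawaAlgebra p)ˣ),
      -- … such that for EVERY admissible twist, EVERY pinned unit tower and ALL coordinates of `[ε_𝔟]` on the `e_k` …
      ∀ 𝔟 : Ideal (𝓞 K), IsCoprime 𝔟 (Ideal.span {((6 * p * f : ℕ) : 𝓞 K)}) →
      ∀ u : F.UnitTower, (∀ s : ℕ, 1 ≤ s → IsKatoUnitRepAt p ι (Ideal.span {((f : ℕ) : 𝓞 K)}) s 𝔟 (u.z s)) →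
      ∀ (b₀ b₁ : ℤ) (Nb : ℕ), Nb ≠ 0 →
        (∀ k s : ℕ, k ≤ s → 1 ≤ s →
          (Nb : ℤ) • ((layerArtin p (Ideal.span {((f : ℕ) : 𝓞 K)}) s 𝔟 • F.e k :
              geomTorsion (W.baseChange K) ((p : ℤ) ^ k)) : geomPoints (W.baseChange K)) =
            b₀ • ((F.e k : geomTorsion (W.baseChange K) ((p : ℤ) ^ k)) : geomPoints (W.baseChange K)) +
              b₁ • φ ((F.e k : geomTorsion (W.baseChange K) ((p : ℤ) ^ k)) : geomPoints (W.baseChange K))) →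
        -- … (15.16.1) after `⊗ ℚ`: `[ε_𝔟]·(p^t M̃)·euK 𝔟 = N𝔟·([ε_𝔟] − σ_𝔟)·(α₀ + α₁φ)·w·res y` (times `N_b`), in `IK.H`
        ((b₀ : IwasawaAlgebra p) * ((p : IwasawaAlgebra p) ^ t *
            katoMultiplier p c d₁ n₁ n₂ n₃ n₄
              ((IwasawaCharacter.Psi p ℤ_[p] κ σc : (PowerSeries ℤ_[p])ˣ) : IwasawaAlgebra p)
              ((IwasawaCharacter.Psi p ℤ_[p] κ σd : (PowerSeries ℤ_[p])ˣ) : IwasawaAlgebra p)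
              (A.primeFactors.erase p) (fun ℓ => W.LFunction ℓ) (fun ℓ => if ℓ ∣ N then 0 else 1)
              (fun ℓ => ((IwasawaCharacter.Psi p ℤ_[p] κ (σℓ ℓ) : (PowerSeries ℤ_[p])ˣ) : IwasawaAlgebra p)))) •
            F.iwasawaClass u (κ.restrict K h) hV IK +
          ((b₁ : IwasawaAlgebra p) * ((p : IwasawaAlgebra p) ^ t *
            katoMultiplier p c d₁ n₁ n₂ n₃ n₄
              ((IwasawaCharacter.Psi p ℤ_[p] κ σc : (PowerSeries ℤ_[p])ˣ) : IwasawaAlgebra p)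
              ((IwasawaCharacter.Psi p ℤ_[p] κ σd : (PowerSeries ℤ_[p])ˣ) : IwasawaAlgebra p)
              (A.primeFactors.erase p) (fun ℓ => W.LFunction ℓ) (fun ℓ => if ℓ ∣ N then 0 else 1)
              (fun ℓ => ((IwasawaCharacter.Psi p ℤ_[p] κ (σℓ ℓ) : (PowerSeries ℤ_[p])ˣ) : IwasawaAlgebra p)))) •
            IK.isogenyMap φ IK hγK (F.iwasawaClass u (κ.restrict K h) hV IK) =
        ((Ideal.absNorm 𝔟 : ℕ) : IwasawaAlgebra p) •
          ((((b₀ : IwasawaAlgebra p) -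
              (Nb : IwasawaAlgebra p) * PowerSeries.binomialSeries ℤ_[p] (ZpExtension.artinExponent (κ.restrict K h) 𝔟)) •
              ((PowerSeries.C α₀ : IwasawaAlgebra p) • ((w : IwasawaAlgebra p) • I.resOver IK hγ hγK y) +
                (PowerSeries.C α₁ : IwasawaAlgebra p) •
                  IK.isogenyMap φ IK hγK ((w : IwasawaAlgebra p) • I.resOver IK hγ hγK y))) +
            (b₁ : IwasawaAlgebra p) •
              IK.isogenyMap φ IK hγK
                ((PowerSeries.C α₀ : IwasawaAlgebra p) • ((w : IwasawaAlgebra p) • I.resOver IK hγ hγK y) +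
                  (PowerSeries.C α₁ : IwasawaAlgebra p) •
                    IK.isogenyMap φ IK hγK ((w : IwasawaAlgebra p) • I.resOver IK hγ hγK y)))

end CM

end Literature.NumberTheory.EllipticCurves.Kato2004

end
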